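import Summits.NavierStokesRegularity.NavierStokesRegularity.Theses.DSolutionBubble
import HarnessLib

/-!
# Crux `NondegenerateBubbleBridge` (stmt-NavierStokesRegularity-4062, route DSolutionBubble) — the BC2 split
# `InnerWeightedSolvability → GluedBubbleWithRate → NondegenerateBubbleBridge`

Theorems-only file (no definitions, no named facts). The deciding crux B⁺ = `NondegenerateBubbleBridge` of the
conditional-bridge route `DSolutionBubble` (a nondegenerate tame-slow steady D-solution glues into a non-Type-I
finite-time singularity of a Leray–Hopf classical solution from a rapidly decaying datum) is cut along the
route's own declared layer-2 seam "InnerSolvability → (outer implosion + modulation)" into two typed pieces,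
both stated INLINE below as hypotheses of the assembly theorem (they become the route's leaves by
`route edit --split`, this theorem being the glue):

* X₁ `InnerWeightedSolvability` — the inner linear theory (so far the informal crux InnerLinearTheory,
  stmt-4384) typed with explicit power weights and no new notion: for every `ν > 0` and every smooth
  divergence-free `U` with a tame slow power tail (`|U| ≤ C⟨y⟩^{-a}`, `‖DU‖ ≤ C⟨y⟩^{-a-1}`, annular `L²` mass
  `≥ c R^{3-2a}`, some `a ∈ (1/2, 2/3)`), the linearised steady operator
  `φ ↦ −νΔφ + (U·∇)φ + (φ·∇)U + ∇π` admits a bounded right inverse, from the weighted-`C¹` sources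
  `|h| ≤ ⟨y⟩^{-b}`, `‖Dh‖ ≤ ⟨y⟩^{-b-1}` lying in the joint kernel of FINITELY many linear functionals, into
  `C²` divergence-free fields with `|φ| ≤ C_s ⟨y⟩^{-m}`, some `m > 0` (finite-codimensional solvability with a
  weighted sup estimate — the input of every inner–outer gluing scheme, cf. Dávila–del Pino–Wei, Invent. Math.
  2020, the linear inner theory of §7).
* X₂ `GluedBubbleWithRate` — the gluing theorem GIVEN that linear theory at the D-solution, with its
  quantitative output: a classical solution on `[0, T)`, Leray–Hopf from its rapidly decaying datum, blowing up
  at `T` at least at a power rate, `c ≤ (T − t)^β ‖u(t, x_t)‖` with `β > 1/2` along points `‖x_t‖ ≤ ρ`.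

The seam is not definitional: the assembly proves that a power rate `β > 1/2` along some points excludes the
Type I bound `‖u(t,x)‖ ≤ C/√(T−t)` (`dsolutionBubble_not_isTypeIBlowup_of_powerRate`), and that pointwise
blow-up along a bounded set of points excludes every smooth extension past `T`, any such extension being
continuous, hence bounded, on the compact `[0, T] × B̄_ρ` (`dsolutionBubble_not_hasSmoothExtensionPast_of_powerRate`);
maximality and the non-Type-I clause of B⁺ are thus DERIVED, not assumed.

## References

* J. Dávila, M. del Pino, J. Wei, *Singularity formation for the two-dimensional harmonic map flow into S²*,
  Invent. Math. 219 (2020) — inner–outer gluing; the inner linear theory as a finite-codimension solvability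
  statement with weighted estimates. [DavilaDelpinoWei2019]
* J. T. Beale, T. Kato, A. Majda, Comm. Math. Phys. 94 (1984), §1 — continuation vocabulary
  (`HasSmoothExtensionPast`, `IsMaximalSmoothSolution`). [BealeKatoMajda1984]
* J. Leray, Acta Math. 63 (1934) — the self-similar (Type I) rate `(T − t)^{-1/2}`. [Leray1934]
-/

noncomputable section

-- the sub-problem namespace repeats the summit name (D-0017 layout `Summit.<S>.<P>.Theorems`)
set_option linter.dupNamespace false

namespace Summit.NavierStokesRegularity.NavierStokesRegularity.Theorems

open MeasureTheory Set Function Filter Topology Metric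
open Literature.Analysis.FluidPDE

/-- **A power rate `β > 1/2` along some points excludes Type I.** If `0 < T`, `1/2 < β`, `0 < c` and for
every `t ∈ [0, T)` some point `x` with `‖x‖ ≤ ρ` has `c ≤ (T − t)^β ‖u(t, x)‖`, then `u` does not blow up
at the Type I rate at `T` (`IsTypeIBlowup u T`: `‖u(t, x)‖ ≤ C/√(T − t)` for all `x` and all `t < T` near
`T`): otherwise `c ≤ C (T − t)^{β − 1/2} → 0` as `t ↑ T`. [folklore] -/
theorem dsolutionBubble_not_isTypeIBlowup_of_powerRate
    {u : ℝ → EuclideanSpace ℝ (Fin 3) → EuclideanSpace ℝ (Fin 3)}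
    {T β ρ c : ℝ} (hT : 0 < T) (hβ : 1 / 2 < β) (hc : 0 < c)
    (hrate : ∀ t ∈ Set.Ico (0 : ℝ) T, ∃ x : EuclideanSpace ℝ (Fin 3), ‖x‖ ≤ ρ ∧ c ≤ (T - t) ^ β * ‖u t x‖) :
    ¬ IsTypeIBlowup u T := by
  rintro ⟨C, hC⟩
  have hcont : ContinuousAt (fun t : ℝ => C * (T - t) ^ (β - 1 / 2)) T := by
    have h1 : ContinuousAt (fun t : ℝ => T - t) T := (continuous_const.sub continuous_id).continuousAt
    have h2 : ContinuousAt (fun s : ℝ => s ^ (β - 1 / 2)) (T - T) := by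
      apply Real.continuousAt_rpow_const
      right; linarith
    exact continuousAt_const.mul (h2.comp h1)
  have hlim : Tendsto (fun t : ℝ => C * (T - t) ^ (β - 1 / 2)) (𝓝[<] T) (𝓝 0) := by
    have := hcont.tendsto
    simp only [sub_self] at this
    rw [Real.zero_rpow (by linarith), mul_zero] at this
    exact tendsto_nhdsWithin_of_tendsto_nhds this
  have h3 : ∀ᶠ t in 𝓝[<] T, C * (T - t) ^ (β - 1 / 2) < c := hlim.eventually_lt_const hc
  have h4 : ∀ᶠ t in 𝓝[<] T, t ∈ Set.Ico (0 : ℝ) T := Ico_mem_nhdsLT hT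
  obtain ⟨t, ht, htI, hlt⟩ := (hC.and (h4.and h3)).exists
  obtain ⟨x, -, hcx⟩ := hrate t htI
  have hTt : 0 < T - t := sub_pos.2 htI.2
  have key : (T - t) ^ β * ‖u t x‖ ≤ C * (T - t) ^ (β - 1 / 2) := by
    calc (T - t) ^ β * ‖u t x‖ ≤ (T - t) ^ β * (C / Real.sqrt (T - t)) := by
          gcongr
          exact ht x
      _ = C * (T - t) ^ (β - 1 / 2) := by
          rw [Real.sqrt_eq_rpow, Real.rpow_sub hTt]
          field_simp
  linarith

/-- **Pointwise blow-up along a bounded set excludes smooth extension.** If `0 < T`, `0 < β`, `0 < c` and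
for every `t ∈ [0, T)` some point `x` with `‖x‖ ≤ ρ` has `c ≤ (T − t)^β ‖u(t, x)‖`, then `u` has no smooth
extension past `T` (`HasSmoothExtensionPast ν 0 u T`): a classical solution `u'` on `[0, T')`, `T' > T`,
agreeing with `u` on `[0, T)` is jointly continuous, hence bounded by some `M` on the compact
`[0, T] × B̄(0, ρ)`, while `c ≤ (T − t)^β M → 0` as `t ↑ T` (Beale–Kato–Majda 1984, §1: the continuation
vocabulary). [folklore] -/
theorem dsolutionBubble_not_hasSmoothExtensionPast_of_powerRate {ν : ℝ}
    {u : ℝ → EuclideanSpace ℝ (Fin 3) → EuclideanSpace ℝ (Fin 3)}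
    {T β ρ c : ℝ} (hT : 0 < T) (hβ : 0 < β) (hc : 0 < c)
    (hrate : ∀ t ∈ Set.Ico (0 : ℝ) T, ∃ x : EuclideanSpace ℝ (Fin 3), ‖x‖ ≤ ρ ∧ c ≤ (T - t) ^ β * ‖u t x‖) :
    ¬ HasSmoothExtensionPast ν 0 u T := by
  rintro ⟨T', hT', u', p', hcl', heq⟩
  have hcont : ContinuousOn (uncurry u') (Set.Icc (0 : ℝ) T ×ˢ closedBall (0 : EuclideanSpace ℝ (Fin 3)) ρ) :=
    hcl'.smooth_velocity.continuousOn.mono (prod_mono (Icc_subset_Ico_right hT') (subset_univ _))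
  have hK : IsCompact (Set.Icc (0 : ℝ) T ×ˢ closedBall (0 : EuclideanSpace ℝ (Fin 3)) ρ) :=
    isCompact_Icc.prod (isCompact_closedBall 0 ρ)
  obtain ⟨M, hM⟩ := hK.exists_bound_of_continuousOn hcont
  have hcontT : ContinuousAt (fun t : ℝ => (T - t) ^ β * |M|) T := by
    have h1 : ContinuousAt (fun t : ℝ => T - t) T := (continuous_const.sub continuous_id).continuousAt
    have h2 : ContinuousAt (fun s : ℝ => s ^ β) (T - T) := by
      apply Real.continuousAt_rpow_const
      right; exact hβ.le
    exact (h2.comp h1).mul continuousAt_const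
  have hlim : Tendsto (fun t : ℝ => (T - t) ^ β * |M|) (𝓝[<] T) (𝓝 0) := by
    have := hcontT.tendsto
    simp only [sub_self] at this
    rw [Real.zero_rpow hβ.ne', zero_mul] at this
    exact tendsto_nhdsWithin_of_tendsto_nhds this
  have h3 : ∀ᶠ t in 𝓝[<] T, (T - t) ^ β * |M| < c := hlim.eventually_lt_const hc
  have h4 : ∀ᶠ t in 𝓝[<] T, t ∈ Set.Ico (0 : ℝ) T := Ico_mem_nhdsLT hT
  obtain ⟨t, htI, hlt⟩ := (h4.and h3).exists
  obtain ⟨x, hx, hcx⟩ := hrate t htI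
  have hTt : 0 < T - t := sub_pos.2 htI.2
  have hmem : (t, x) ∈ Set.Icc (0 : ℝ) T ×ˢ closedBall (0 : EuclideanSpace ℝ (Fin 3)) ρ :=
    ⟨⟨htI.1, htI.2.le⟩, mem_closedBall_zero_iff.2 hx⟩
  have hbound : ‖u t x‖ ≤ |M| := by
    have h := hM (t, x) hmem
    simp only [uncurry_apply_pair] at h
    rw [heq t htI] at h
    exact h.trans (le_abs_self M)
  have key : (T - t) ^ β * ‖u t x‖ ≤ (T - t) ^ β * |M| := by
    gcongr
  linarith

/-- **The split of crux B⁺** (BC2 redirect, glue of `route edit --split NondegenerateBubbleBridge --into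
InnerWeightedSolvability GluedBubbleWithRate`): the inner weighted solvability X₁ (first hypothesis, the
typed InnerLinearTheory) and the gluing-with-rate theorem X₂ (second hypothesis) imply
`DSolutionBubble.NondegenerateBubbleBridge`. Given the antecedent of B⁺ (a nondegenerate tame-slow
D-solution `U` at viscosity `ν`), X₁ at `(ν, U)` (using `U` smooth, `div U = 0` from `IsLerayProfile.divFree`,
and the tail block) supplies the finite-codimensional weighted solvability of the linearised steady operator;
X₂ turns the D-solution plus that solvability into a classical Leray–Hopf solution from a rapidly decaying
datum with a power blow-up rate `β > 1/2` along bounded points; the two lemmas above convert the rate into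
`IsMaximalSmoothSolution` (no smooth extension) and `¬ IsTypeIBlowup`. [cite: DavilaDelpinoWei2019, §7 (inner linear theory as the input of the gluing)] -/
theorem dsolutionBubble_nondegenerateBubbleBridge_of_split
    (hX₁ : ∀ ν : ℝ, 0 < ν → ∀ (U : EuclideanSpace ℝ (Fin 3) → EuclideanSpace ℝ (Fin 3)), ContDiff ℝ (⊤ : ℕ∞) U → Literature.Analysis.FluidPDE.VectorCalculus.IsDivFree U → (∃ a : ℝ, 1 / 2 < a ∧ a < 2 / 3 ∧ ∃ C c : ℝ, 0 < c ∧ (∀ y, ‖U y‖ ≤ C * (1 + ‖y‖) ^ (-a) ∧ ‖fderiv ℝ U y‖ ≤ C * (1 + ‖y‖) ^ (-(a + 1))) ∧ ∀ R : ℝ, 1 ≤ R → c * R ^ (3 - 2 * a) ≤ ∫ y in {y : EuclideanSpace ℝ (Fin 3) | R ≤ ‖y‖ ∧ ‖y‖ ≤ 2 * R}, ‖U y‖ ^ 2) → (∃ (b m Cs : ℝ) (k : ℕ) (ℓ : Fin k → ((EuclideanSpace ℝ (Fin 3) → EuclideanSpace ℝ (Fin 3)) →ₗ[ℝ] ℝ)),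 0 < m ∧ ∀ h : EuclideanSpace ℝ (Fin 3) → EuclideanSpace ℝ (Fin 3), ContDiff ℝ 1 h → (∀ y, ‖h y‖ ≤ (1 + ‖y‖) ^ (-b) ∧ ‖fderiv ℝ h y‖ ≤ (1 + ‖y‖) ^ (-(b + 1))) → (∀ i, ℓ i h = 0) → ∃ (φ : EuclideanSpace ℝ (Fin 3) → EuclideanSpace ℝ (Fin 3)) (π : EuclideanSpace ℝ (Fin 3) → ℝ), ContDiff ℝ 2 φ ∧ ContDiff ℝ 1 π ∧ (∀ y, -(ν • Laplacian.laplacian φ y) + Literature.Analysis.FluidPDE.convect U φ y + Literature.Analysis.FluidPDE.convect φ U y + gradient π y = h y) ∧ Literature.Analysis.FluidPDE.VectorCalculus.IsDivFree φ ∧ ∀ y, ‖φ y‖ ≤ Cs * (1 + ‖y‖) ^ (-m)))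
    (hX₂ : ∀ ν : ℝ, 0 < ν → ∀ (U : EuclideanSpace ℝ (Fin 3) → EuclideanSpace ℝ (Fin 3)) (P : EuclideanSpace ℝ (Fin 3) → ℝ), (Literature.Analysis.FluidPDE.IsLerayProfile ν 0 U P ∧ ContDiff ℝ (⊤ : ℕ∞) U ∧ ContDiff ℝ (⊤ : ℕ∞) P ∧ (∫⁻ y, ENNReal.ofReal (Literature.Analysis.FluidPDE.frobeniusNormSq (fderiv ℝ U y)) < ⊤) ∧ Filter.Tendsto U (Filter.cocompact (EuclideanSpace ℝ (Fin 3))) (nhds 0) ∧ U ≠ 0 ∧ (∃ a : ℝ, 1 / 2 < a ∧ a < 2 / 3 ∧ ∃ C c : ℝ, 0 < c ∧ (∀ y, ‖U y‖ ≤ C * (1 + ‖y‖) ^ (-a) ∧ ‖fderiv ℝ U y‖ ≤ C * (1 + ‖y‖) ^ (-(a + 1))) ∧ ∀ R : ℝ, 1 ≤ R → c * R ^ (3 - 2 * a) ≤ ∫ y in {y : EuclideanSpace ℝ (Fin 3) | R ≤ ‖y‖ ∧ ‖y‖ ≤ 2 * R}, ‖U y‖ ^ 2) ∧ (∀ (φ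 : EuclideanSpace ℝ (Fin 3) → EuclideanSpace ℝ (Fin 3)) (π : EuclideanSpace ℝ (Fin 3) → ℝ), ContDiff ℝ 2 φ → ContDiff ℝ 1 π → (∀ y, -(ν • Laplacian.laplacian φ y) + Literature.Analysis.FluidPDE.convect U φ y + Literature.Analysis.FluidPDE.convect φ U y + gradient π y = 0) → Literature.Analysis.FluidPDE.VectorCalculus.IsDivFree φ → (∫⁻ y, ENNReal.ofReal (Literature.Analysis.FluidPDE.frobeniusNormSq (fderiv ℝ φ y)) < ⊤) → Filter.Tendsto φ (Filter.cocompact (EuclideanSpace ℝ (Fin 3))) (nhds 0) → ∃ (e : EuclideanSpace ℝ (Fin 3)) (s : ℝ) (A : EuclideanSpace ℝ (Fin 3) →ₗ[ℝ] EuclideanSpace ℝ (Fin 3)), (∀ x y : EuclideanSpace ℝ (Fin 3), @inner ℝ _ _ (A x) y = -(@inner ℝ _ _ x (A y))) ∧ ∀ y, φ y = fderiv ℝ U y e + s • (U y + fderiv ℝ U y y) + (A (U y) - fderiv ℝ U y (A y)))) → (∃ (b m Cs : ℝ) (k : ℕ) (ℓ : Fin k → ((EuclideanSpace ℝ (Fin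 3) → EuclideanSpace ℝ (Fin 3)) →ₗ[ℝ] ℝ)), 0 < m ∧ ∀ h : EuclideanSpace ℝ (Fin 3) → EuclideanSpace ℝ (Fin 3), ContDiff ℝ 1 h → (∀ y, ‖h y‖ ≤ (1 + ‖y‖) ^ (-b) ∧ ‖fderiv ℝ h y‖ ≤ (1 + ‖y‖) ^ (-(b + 1))) → (∀ i, ℓ i h = 0) → ∃ (φ : EuclideanSpace ℝ (Fin 3) → EuclideanSpace ℝ (Fin 3)) (π : EuclideanSpace ℝ (Fin 3) → ℝ), ContDiff ℝ 2 φ ∧ ContDiff ℝ 1 π ∧ (∀ y, -(ν • Laplacian.laplacian φ y) + Literature.Analysis.FluidPDE.convect U φ y + Literature.Analysis.FluidPDE.convect φ U y + gradient π y = h y) ∧ Literature.Analysis.FluidPDE.VectorCalculus.IsDivFree φ ∧ ∀ y, ‖φ y‖ ≤ Cs * (1 + ‖y‖) ^ (-m)) → ∃ T : ℝ, 0 < T ∧ ∃ (u : ℝ → EuclideanSpace ℝ (Fin 3) → EuclideanSpace ℝ (Fin 3)) (p : ℝ → EuclideanSpace ℝ (Fin 3) → ℝ), Literature.Analysis.FluidPDE.IsClassicalNSSolutionOn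 (Set.Ico 0 T) ν 0 u p ∧ Literature.Analysis.FluidPDE.IsLerayHopfOn T ν 0 (u 0) u ∧ Literature.Analysis.FluidPDE.HasRapidSpatialDecay (u 0) ∧ ∃ β ρ c : ℝ, 1 / 2 < β ∧ 0 < c ∧ ∀ t ∈ Set.Ico (0 : ℝ) T, ∃ x : EuclideanSpace ℝ (Fin 3), ‖x‖ ≤ ρ ∧ c ≤ (T - t) ^ β * ‖u t x‖) :
    Theses.DSolutionBubble.NondegenerateBubbleBridge := by
  rintro ⟨ν, hν, U, P, hprof, hU, hP, hDir, hdec, hne, htail, hnd⟩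
  have hsolv := hX₁ ν hν U hU hprof.divFree htail
  obtain ⟨T, hT, u, p, hcl, hLH, hdat, β, ρ, c, hβ, hc, hrate⟩ :=
    hX₂ ν hν U P ⟨hprof, hU, hP, hDir, hdec, hne, htail, hnd⟩ hsolv
  exact ⟨ν, hν, T, hT, u, p,
    ⟨hcl, dsolutionBubble_not_hasSmoothExtensionPast_of_powerRate hT (by linarith) hc hrate⟩, hLH, hdat,
    dsolutionBubble_not_isTypeIBlowup_of_powerRate hT hβ hc hrate⟩

end Summit.NavierStokesRegularity.NavierStokesRegularity.Theorems
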